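import Literature.NumberTheory.GaloisRepresentations.ContinuousCohomologyConnecting
import HarnessLib

/-!
# `H²` injects into the product of the `H²` of the factors along a jointly bijective family

Topic `NumberTheory/GaloisRepresentations` (continuous cochain cohomology in degree `2`; sequel to
`ContinuousH2.lean` / `ContinuousCohomologyConnecting.lean`). One theorem, no definition, no named fact,
no `sorry`, no instance.

Let `G` be a locally compact topological group, `X` and `Y_i` (`i ∈ ι`) topological `G`-modules and
`π_i : X ⟶ Y_i` morphisms such that `x ↦ (π_i x)_i : X → Π_i Y_i` is a homeomorphic bijection — recorded
through a continuous two-sided inverse `s : Π_i Y_i → X`.  Then a class `z ∈ H²(G, X)` with `H²(π_i) z = 0`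
for every `i` is zero: `H²(G, Π_i Y_i) → Π_i H²(G, Y_i)` is injective ("cohomology commutes with
products", Brown, *Cohomology of Groups*, III (6.6)/Prop. 6.7 for `Hom`/products of coefficient modules;
Neukirch–Schmidt–Wingberg (1.3.x): `Hⁿ(G, Π A_i) = Π Hⁿ(G, A_i)`).  Proof on continuous inhomogeneous
`2`-cocycles (`twoCocycleClass_surjective`, `twoCocycleClass_eq_zero_iff`): if `π_i ∘ c = ∂ b_i` for continuous
`1`-cochains `b_i : G → Y_i`, then `c = ∂ (s ∘ (b_i)_i)`.

WHY (cell `pub/bsd-print-x9`, Howard 2004 H.4): Howard's induced local pairing is valued in `H²(K_v, R(1))` for a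
finite level ring `R ⊃ ℤ/p^k`; the tree's local duality speaks of `H²(K_v, μ_{p^k})`. Reading `R(1) ≅ Π_i μ_{p^k}`
through a dualizing family of characters, this lemma is the injectivity of the readout
`H²(K_v, R(1)) → Π_i H²(K_v, μ_{p^k})`. BSD is not proved by any of this.

References: [Brown1982CohomologyGroups] K. S. Brown, *Cohomology of Groups* (1982), III §6 (compatibility of
`H^*` with products of coefficients); [NeukirchSchmidtWingberg2008] J. Neukirch, A. Schmidt, K. Wingberg,
*Cohomology of Number Fields*, 2nd ed. (2008), I §3; [SerreGaloisCohomology1997] J.-P. Serre, *Galois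
Cohomology* (1997), I §2.2–2.3 (continuous cochains, factor systems).
-/

noncomputable section

open CategoryTheory Function

universe u v w

namespace Literature.NumberTheory.GaloisRepresentations

open _root_.TopRep _root_.ContinuousCohomology

variable {k : Type u} [CommRing k] [TopologicalSpace k]
variable {G : Type v} [Group G] [TopologicalSpace G] [IsTopologicalGroup G] [LocallyCompactSpace G]

/-- **`H²(G, X) → Π_i H²(G, Y_i)` is injective when `X → Π_i Y_i` is a topological isomorphism**: for
morphisms `π_i : X ⟶ Y_i` of topological `G`-modules admitting a continuous map `s : Π_i Y_i → X` with
`π_i (s y) = y_i` and `s ((π_i x)_i) = x`, a class `z ∈ H²(G, X)` with `H²(π_i) z = 0` for all `i` vanishes.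
(On inhomogeneous continuous `2`-cocycles: `π_i ∘ c = ∂ b_i` for all `i` forces `c = ∂ (s ∘ (b_i)_i)`.)
[cite: Brown1982CohomologyGroups, III §6 (H^* and products of coefficient modules)]
[cite: SerreGaloisCohomology1997, I §2.3] -/
theorem twoCohomology_eq_zero_of_forall_cohomologyMap_eq_zero {ι : Type w} {X : TopRep.{v} k G}
    {Y : ι → TopRep.{v} k G} (π : ∀ i, X ⟶ Y i) (s : (∀ i, Y i) → X) (hs : Continuous s)
    (hπs : ∀ (y : ∀ i, Y i) (i : ι), (π i).hom (s y) = y i)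
    (hsπ : ∀ x : X, s (fun i => (π i).hom x) = x)
    (z : continuousCohomology 2 X) (hz : ∀ i, cohomologyMap (π i) 2 z = 0) : z = 0 := by
  obtain ⟨c, rfl⟩ := twoCocycleClass_surjective X z
  have hb : ∀ i, ∃ b : C(G, Y i), ∀ σ τ : G,
      (π i).hom (c.1 (σ, τ)) = (Y i).ρ σ (b τ) - b (σ * τ) + b σ := by
    intro i
    have h := hz i
    rw [cohomologyMap_twoCocycleClass, twoCocycleClass_eq_zero_iff] at h
    obtain ⟨b, hb⟩ := h
    exact ⟨b, fun σ τ => by rw [← hb σ τ, pullback₂_id_resIdHom_apply]⟩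
  choose b hb using hb
  let B : C(G, X) := ⟨fun g => s (fun i => b i g), hs.comp (continuous_pi fun i => (b i).continuous)⟩
  rw [twoCocycleClass_eq_zero_iff]
  refine ⟨B, fun σ τ => ?_⟩
  have hinj : ∀ x x' : X, (∀ i, (π i).hom x = (π i).hom x') → x = x' := by
    intro x x' h
    rw [← hsπ x, ← hsπ x']
    exact congrArg s (funext h)
  refine hinj _ _ fun i => ?_
  rw [hb i σ τ, map_add, map_sub, TopRep.hom_comm_apply]
  simp only [B, ContinuousMap.coe_mk, hπs]

end Literature.NumberTheory.GaloisRepresentations
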